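import Literature.Topology.FourManifolds.ThreeTorusHomologyOne
import Literature.Topology.FourManifolds.ThreeTorusLinearDegree
import Literature.Topology.FourManifolds.CappellShanesonWangProofs
import Literature.Topology.FourManifolds.HomotopyS4Criterion
import Literature.AlgebraicTopology.SingularHomology.PoincareDuality
import Literature.AlgebraicTopology.SingularHomology.KroneckerDegreeOne
import HarnessLib

/-!
# `H₂` of the 3-torus with its `SL(3, ℤ)`-action from Poincaré duality, and the torus input of
# Cappell–Shaneson

Third file (after `ThreeTorusHomologyOne.lean`, `ThreeTorusLinearDegree.lean`) on the named fact
`Literature.Topology.FourManifolds.singularHomology_threeTorus_linear` (`CappellShanesonWang.lean`;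
A. Hatcher, *Algebraic Topology* (2002), §3.C Exercise 11 / Example 3.16), the last torus-specific
leaf of the decomposition of
`Literature.Topology.FourManifolds.nonempty_homotopyEquiv_sphere_four_of_isCappellShanesonSphere`
(S. E. Cappell, J. L. Shaneson, *Some new four-manifolds*, Ann. of Math. 104 (1976), §2).

The `H₂` half of that fact — `H₂(T³; ℤ) ≅ ℤ³` with `torusMap A` acting by `(A⁻¹)ᵀ` — is **proved
here from Poincaré duality for `T³`** (Hatcher Thm. 3.30, the tree's named fact
`Literature.AlgebraicTopology.SingularHomology.bijective_poincareDualityMap`, in the single instance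
`X = T³`, `(p, q) = (1, 2)`, orientation `ThreeTorus.homologicalOrientation`), which is the printed
mechanism of Hatcher Example 3.16 / §3.C Ex. 11 read homologically:

* `D : H¹(T³; ℤ) → H₂(T³; ℤ)`, `a ↦ a ⌢ [T³]`, is bijective (the hypothesis `hPD`) and satisfies
  `f_* (D (f^* a)) = D a` for `f = torusMap A` (projection formula `capProduct_map`, proved in the
  tree, and `f_* [T³] = [T³]`, `ThreeTorus.map_torusMapC_fundamentalClass`, proved in
  `ThreeTorusLinearDegree.lean`);
* the Kronecker map `κ : H¹(T³; ℤ) → Hom(H₁(T³; ℤ), ℤ)` is bijective (universal coefficients in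
  degree one, proved in the tree: `kroneckerPairing_one_bijective`) and natural
  (`kroneckerPairing_map`);
* `H₁(T³; ℤ) ≅ ℤ³` with `f_* = A` (`ThreeTorusHomologyOne.lean`), so `Hom(H₁(T³), ℤ) ≅ ℤ³` by
  evaluating on the coordinate circles (`ThreeTorus.dualCoordEquiv`);
* hence `β₂ := dualCoord ∘ κ ∘ D⁻¹ : H₂(T³; ℤ) ≅ ℤ³` conjugates `f_*` to `(Aᵀ)⁻¹ = (A⁻¹)ᵀ`
  (`ThreeTorus.map_torusMapC_two_comp_iso`).

## Main statements

* `Literature.Topology.FourManifolds.ThreeTorus.singularHomologyTwoThreeTorusIso hPD : H₂(T³; ℤ) ≅ ℤ³`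
  and `….map_torusMapC_two_comp_iso` (proved from `hPD`).
* **`Literature.Topology.FourManifolds.singularHomology_threeTorus_linear_of_poincareDuality`**:
  the named fact `singularHomology_threeTorus_linear` from `hPD` alone, where `hPD : PD₃` is the
  term `@bijective_poincareDualityMap ℤ _ ThreeTorus _ 1 2 3 _ _ threeTorusChartedSpaceFinThree
  ThreeTorus.homologicalOrientation rfl` (local notation; no local instance is declared).
* **`Literature.Topology.FourManifolds.nonempty_homotopyEquiv_sphere_four_of_isCappellShanesonSphere_of_poincareDuality`**:
  the Cappell–Shaneson target fact, in every universe, from (PD₃) Poincaré duality for `T³` in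
  degrees `(1, 2)` and (W) the recognition of homotopy 4-spheres `spc4.S10` at universe `0`.
* **`Literature.Topology.FourManifolds.nonempty_homotopyEquiv_sphere_four_of_isCappellShanesonSphere_of_textbookFacts`**:
  the target fact from exactly the three general textbook named facts behind `spc4.S10`
  (`HomotopyS4Criterion.lean`): Poincaré duality (Hatcher Thm. 3.30), Whitehead's theorem
  (Cor. 4.33) and the CW homotopy type of compact manifolds (Cor. A.12). No torus-specific or
  Cappell–Shaneson-specific statement remains unproved.

Everything here is proved; the new data are linear equivalences / isomorphisms built from the
hypotheses.

## References

* A. Hatcher, *Algebraic Topology*, CUP 2002, §3.1 Thm. 3.2; §3.3 Thm. 3.30, p. 241; §3.C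
  Exercise 11, Example 3.16; Cor. 4.33; Cor. A.12 [HatcherAT2002].
* S. E. Cappell, J. L. Shaneson, *Some new four-manifolds*, Ann. of Math. 104 (1976) 61–72, §2
  [CappellShanesonAnnals1976].
-/

noncomputable section

open CategoryTheory Limits Set
open Literature.AlgebraicTopology.SingularHomology

namespace Literature.Topology.FourManifolds

universe u

/-- Local notation: `𝔼 n` is the model Euclidean space `EuclideanSpace ℝ (Fin n)`. -/
local notation "𝔼 " n:arg => EuclideanSpace ℝ (Fin n)

/-- Local notation: **Poincaré duality for `T³` in degrees `(1, 2)`** — the instance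
`X = T³` (a closed topological 3-manifold through `threeTorusChartedSpaceFinThree`), `R = ℤ`,
`p = 1`, `q = 2`, orientation `ThreeTorus.homologicalOrientation` of the tree's named fact
`bijective_poincareDualityMap` (Hatcher Thm. 3.30): `a ↦ a ⌢ [T³] : H¹(T³; ℤ) → H₂(T³; ℤ)` is
bijective. Written with all implicit arguments so that no local instance is needed. -/
local notation "PD₃" => @bijective_poincareDualityMap ℤ _ ThreeTorus _ 1 2 3 _ _
  threeTorusChartedSpaceFinThree ThreeTorus.homologicalOrientation rfl

namespace ThreeTorus

/-! ### `Hom(H₁(T³; ℤ), ℤ) ≅ ℤ³` by evaluation on the coordinate circles -/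

/-- The class `xᵢ ∈ H₁(T³; ℤ)` of the `i`-th coordinate circle: the preimage of the `i`-th basis
vector under `H₁(T³; ℤ) ≅ ℤ³` (Hatcher 2002, §3.C Exercise 11). [cite: HatcherAT2002, §3.C Exercise 11] -/
def classOne (i : Fin 3) : singularHomology ℤ ℤ ThreeTorus 1 :=
  singularHomologyOneThreeTorusIso.inv (Pi.single i 1)

/-- The coordinates of `xᵢ` are the `i`-th basis vector. [folklore] -/
theorem iso_hom_classOne (i : Fin 3) :
    singularHomologyOneThreeTorusIso.hom (classOne i) = Pi.single i 1 := by
  rw [classOne, Iso.inv_hom_id_apply]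

/-- Every `y ∈ H₁(T³; ℤ)` is `Σᵢ (β₁ y)ᵢ • xᵢ`. [folklore] -/
theorem sum_coord_smul_classOne (y : singularHomology ℤ ℤ ThreeTorus 1) :
    ∑ i, singularHomologyOneThreeTorusIso.hom y i • classOne i = y := by
  have h : ∀ v : Fin 3 → ℤ, ∑ i, v i • (Pi.single i (1 : ℤ) : Fin 3 → ℤ) = v := fun v ↦ by
    ext j
    simp [Finset.sum_apply, Pi.single_apply]
  calc ∑ i, singularHomologyOneThreeTorusIso.hom y i • classOne i
      = singularHomologyOneThreeTorusIso.inv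
          (∑ i, singularHomologyOneThreeTorusIso.hom y i • (Pi.single i (1 : ℤ) : Fin 3 → ℤ)) := by
        rw [map_sum]
        refine Finset.sum_congr rfl fun i _ ↦ ?_
        rw [map_zsmul]
        rfl
    _ = y := by rw [h, Iso.hom_inv_id_apply]

/-- **The action of `torusMap B` on the coordinate classes is by the columns of `B`**:
`(torusMap B)_* xᵢ = Σⱼ Bⱼᵢ • xⱼ` (Hatcher 2002, §3.C Exercise 11; from
`map_torusMapC_one_comp_iso`). [cite: HatcherAT2002, §3.C Exercise 11] -/
theorem map_torusMapC_classOne (B : Matrix.SpecialLinearGroup (Fin 3) ℤ) (i : Fin 3) :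
    singularHomology.map ℤ ℤ (torusMapC B) 1 (classOne i) = ∑ j, B.1 j i • classOne j := by
  have h : singularHomologyOneThreeTorusIso.hom (singularHomology.map ℤ ℤ (torusMapC B) 1 (classOne i)) =
      Matrix.mulVec B.1 (singularHomologyOneThreeTorusIso.hom (classOne i)) :=
    congrArg (fun φ ↦ φ (classOne i)) (map_torusMapC_one_comp_iso B)
  have h' : singularHomologyOneThreeTorusIso.hom (singularHomology.map ℤ ℤ (torusMapC B) 1 (classOne i)) =
      fun j ↦ B.1 j i := by
    rw [h, iso_hom_classOne, Matrix.mulVec_single_one]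
    rfl
  calc singularHomology.map ℤ ℤ (torusMapC B) 1 (classOne i)
      = ∑ j, singularHomologyOneThreeTorusIso.hom
          (singularHomology.map ℤ ℤ (torusMapC B) 1 (classOne i)) j • classOne j :=
        (sum_coord_smul_classOne _).symm
    _ = ∑ j, B.1 j i • classOne j := by rw [h']

/-- **Evaluation on the coordinate classes**, `φ ↦ (φ xᵢ)ᵢ : Hom(H₁(T³; ℤ), ℤ) → ℤ³`. [folklore] -/
def dualCoord : (singularHomology ℤ ℤ ThreeTorus 1 →ₗ[ℤ] ℤ) →ₗ[ℤ] (Fin 3 → ℤ) :=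
  LinearMap.pi fun i ↦ LinearMap.applyₗ (classOne i)

/-- Values of `dualCoord`. [folklore] -/
@[simp] theorem dualCoord_apply (φ : singularHomology ℤ ℤ ThreeTorus 1 →ₗ[ℤ] ℤ) (i : Fin 3) :
    dualCoord φ i = φ (classOne i) := rfl

/-- The `i`-th coordinate functional `y ↦ (β₁ y)ᵢ` on `H₁(T³; ℤ)`. [folklore] -/
def coordFun (i : Fin 3) : singularHomology ℤ ℤ ThreeTorus 1 →ₗ[ℤ] ℤ :=
  (LinearMap.proj i).comp singularHomologyOneThreeTorusIso.hom.hom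

/-- Values of `coordFun`. [folklore] -/
@[simp] theorem coordFun_apply (i : Fin 3) (y : singularHomology ℤ ℤ ThreeTorus 1) :
    coordFun i y = singularHomologyOneThreeTorusIso.hom y i := rfl

/-- `coordFunᵢ (xⱼ) = δᵢⱼ`. [folklore] -/
theorem coordFun_classOne (i j : Fin 3) : coordFun i (classOne j) = if i = j then 1 else 0 := by
  rw [coordFun_apply, iso_hom_classOne, Pi.single_apply]

/-- The inverse of `dualCoord`: `v ↦ Σᵢ vᵢ • coordFunᵢ`. [folklore] -/
def dualCoordInv : (Fin 3 → ℤ) →ₗ[ℤ] (singularHomology ℤ ℤ ThreeTorus 1 →ₗ[ℤ] ℤ) where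
  toFun v := ∑ i, v i • coordFun i
  map_add' v w := by
    simp only [Pi.add_apply, add_smul, Finset.sum_add_distrib]
  map_smul' c v := by
    simp only [Pi.smul_apply, smul_eq_mul, RingHom.id_apply, Finset.smul_sum, smul_smul]

/-- Values of `dualCoordInv`. [folklore] -/
theorem dualCoordInv_apply (v : Fin 3 → ℤ) (y : singularHomology ℤ ℤ ThreeTorus 1) :
    dualCoordInv v y = ∑ i, v i * singularHomologyOneThreeTorusIso.hom y i := by
  change (∑ i, v i • coordFun i) y = _
  rw [LinearMap.sum_apply]
  refine Finset.sum_congr rfl fun i _ ↦ ?_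
  rw [LinearMap.smul_apply, coordFun_apply, smul_eq_mul]

/-- **`Hom(H₁(T³; ℤ), ℤ) ≅ ℤ³`** by evaluation on the coordinate classes (the dual basis of the
basis `x₀, x₁, x₂` of `H₁(T³; ℤ) ≅ ℤ³`; Hatcher 2002, §3.1, `Hom(ℤ³, ℤ) = ℤ³`). [folklore] -/
def dualCoordEquiv : (singularHomology ℤ ℤ ThreeTorus 1 →ₗ[ℤ] ℤ) ≃ₗ[ℤ] (Fin 3 → ℤ) :=
  LinearEquiv.ofLinear dualCoord dualCoordInv
    (by
      refine LinearMap.ext fun v ↦ funext fun j ↦ ?_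
      rw [LinearMap.comp_apply, LinearMap.id_apply, dualCoord_apply, dualCoordInv_apply,
        iso_hom_classOne, Finset.sum_eq_single_of_mem j (Finset.mem_univ j)]
      · rw [Pi.single_apply, if_pos rfl, mul_one]
      · intro i _ hij
        rw [Pi.single_apply, if_neg hij, mul_zero])
    (by
      refine LinearMap.ext fun φ ↦ LinearMap.ext fun y ↦ ?_
      rw [LinearMap.comp_apply, LinearMap.id_apply, dualCoordInv_apply]
      simp_rw [dualCoord_apply]
      conv_rhs => rw [← sum_coord_smul_classOne y]
      rw [map_sum]
      refine Finset.sum_congr rfl fun i _ ↦ ?_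
      rw [map_zsmul, smul_eq_mul, mul_comm])

/-- Values of `dualCoordEquiv`. [folklore] -/
@[simp] theorem dualCoordEquiv_apply (φ : singularHomology ℤ ℤ ThreeTorus 1 →ₗ[ℤ] ℤ) (i : Fin 3) :
    dualCoordEquiv φ i = φ (classOne i) := rfl

/-! ### `H₂(T³; ℤ) ≅ ℤ³` from Poincaré duality -/

/-- **The Kronecker isomorphism `H¹(T³; ℤ) ≅ Hom(H₁(T³; ℤ), ℤ)`** (universal coefficients in
degree one, Hatcher Thm. 3.2, proved in the tree: `kroneckerPairing_one_bijective`). [cite: HatcherAT2002, §3.1 Thm. 3.2] -/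
def kroneckerEquiv :
    singularCohomology ℤ ℤ ThreeTorus 1 ≃ₗ[ℤ] (singularHomology ℤ ℤ ThreeTorus 1 →ₗ[ℤ] ℤ) :=
  LinearEquiv.ofBijective (kroneckerPairing ℤ ℤ ThreeTorus 1) (kroneckerPairing_one_bijective ℤ)

/-- Values of `kroneckerEquiv`. [folklore] -/
@[simp] theorem kroneckerEquiv_apply (a : singularCohomology ℤ ℤ ThreeTorus 1) :
    kroneckerEquiv a = kroneckerPairing ℤ ℤ ThreeTorus 1 a := rfl

variable (hPD : PD₃)

/-- **The duality isomorphism `D : H¹(T³; ℤ) ≃ H₂(T³; ℤ)`, `a ↦ a ⌢ [T³]`**, from the hypothesis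
`PD₃` (Hatcher Thm. 3.30 for `T³`; the tree's `poincareDualityEquiv` at the manifold structure
`threeTorusChartedSpaceFinThree`). [cite: HatcherAT2002, §3.3 Thm. 3.30] -/
def pdEquiv : singularCohomology ℤ ℤ ThreeTorus 1 ≃ₗ[ℤ] singularHomology ℤ ℤ ThreeTorus 2 :=
  @poincareDualityEquiv ℤ _ ThreeTorus _ 1 2 3 _ _ threeTorusChartedSpaceFinThree
    homologicalOrientation rfl hPD

/-- `D a = a ⌢ [T³]`. [folklore] -/
@[simp] theorem pdEquiv_apply (a : singularCohomology ℤ ℤ ThreeTorus 1) :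
    pdEquiv hPD a = poincareDualityMap homologicalOrientation (rfl : 1 + 2 = 3) a := rfl

/-- **`H₂(T³; ℤ) ≃ ℤ³` (as `ℤ`-modules), given Poincaré duality for `T³`**:
`β₂ = dualCoord ∘ κ ∘ D⁻¹` with `D a = a ⌢ [T³]` (Hatcher 2002, Example 3.16 / §3.C Ex. 11 via
Thm. 3.30 and Thm. 3.2). [cite: HatcherAT2002, §3.3 Thm. 3.30] -/
def singularHomologyTwoThreeTorusEquiv : singularHomology ℤ ℤ ThreeTorus 2 ≃ₗ[ℤ] (Fin 3 → ℤ) :=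
  (pdEquiv hPD).symm ≪≫ₗ kroneckerEquiv ≪≫ₗ dualCoordEquiv

/-- Values of `singularHomologyTwoThreeTorusEquiv`: `β₂(y)ᵢ = ⟨D⁻¹ y, xᵢ⟩`. [folklore] -/
theorem singularHomologyTwoThreeTorusEquiv_apply (y : singularHomology ℤ ℤ ThreeTorus 2) (i : Fin 3) :
    singularHomologyTwoThreeTorusEquiv hPD y i =
      kroneckerPairing ℤ ℤ ThreeTorus 1 ((pdEquiv hPD).symm y) (classOne i) := rfl

/-- **`H₂(T³; ℤ) ≅ ℤ³` in `ModuleCat ℤ`, given Poincaré duality for `T³`.**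
[cite: HatcherAT2002, §3.3 Thm. 3.30] -/
def singularHomologyTwoThreeTorusIso : singularHomology ℤ ℤ ThreeTorus 2 ≅ ModuleCat.of ℤ (Fin 3 → ℤ) :=
  (singularHomologyTwoThreeTorusEquiv hPD).toModuleIso

/-- `torusMap A⁻¹ ∘ torusMap A = id` as continuous maps. [folklore] -/
theorem torusMapC_inv_comp (A : Matrix.SpecialLinearGroup (Fin 3) ℤ) :
    (torusMapC A⁻¹).comp (torusMapC A) = ContinuousMap.id ThreeTorus := by
  ext z : 1
  change (torusMap (A⁻¹).1 ∘ torusMap A.1) z = z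
  rw [← torusMap_mul, ← Matrix.SpecialLinearGroup.coe_mul, inv_mul_cancel,
    Matrix.SpecialLinearGroup.coe_one, torusMap_one, id]

/-- **Duality intertwines `(torusMap A)_*` with `(torusMap A⁻¹)^*`**: for `a ∈ H¹(T³; ℤ)`,
`(torusMap A)_* (D ((torusMap A)^* ((torusMap A⁻¹)^* a))) = D ((torusMap A⁻¹)^* a)`, i.e.
`f_* ∘ D ∘ f^* = D` — the projection formula `f_*(f^* b ⌢ [T³]) = b ⌢ f_* [T³]` (Hatcher p. 241,
`capProduct_map`) with `f_* [T³] = [T³]` (`map_torusMapC_fundamentalClass`). [cite: HatcherAT2002, §3.3 p. 241] -/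
theorem map_torusMapC_poincareDualityMap (A : Matrix.SpecialLinearGroup (Fin 3) ℤ)
    (b : singularCohomology ℤ ℤ ThreeTorus 1) :
    singularHomology.map ℤ ℤ (torusMapC A) 2
        (poincareDualityMap homologicalOrientation (rfl : 1 + 2 = 3)
          (singularCohomology.map ℤ ℤ (torusMapC A) 1 b)) =
      poincareDualityMap homologicalOrientation (rfl : 1 + 2 = 3) b := by
  rw [poincareDualityMap_apply, poincareDualityMap_apply, capProduct_map,
    map_torusMapC_fundamentalClass]

/-- **The action of `SL(3, ℤ)` on `H₂(T³; ℤ) ≅ ℤ³` is by `(A⁻¹)ᵀ`**, given Poincaré duality for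
`T³`: `(torusMap A)_* ≫ β₂ = β₂ ≫ (v ↦ (A⁻¹)ᵀ v)` (Hatcher 2002, §3.C Exercise 11 / Example 3.16:
`A` acts on `H₂(T³) = Λ²ℤ³` by the cofactor matrix `(A⁻¹)ᵀ`; Cappell–Shaneson 1976, §2).
[cite: HatcherAT2002, §3.C Exercise 11] -/
theorem map_torusMapC_two_comp_iso (A : Matrix.SpecialLinearGroup (Fin 3) ℤ) :
    singularHomology.map ℤ ℤ (torusMapC A) 2 ≫ (singularHomologyTwoThreeTorusIso hPD).hom =
      (singularHomologyTwoThreeTorusIso hPD).hom ≫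
        ModuleCat.ofHom (Matrix.mulVecLin ((A⁻¹).1.transpose)) := by
  apply ModuleCat.hom_ext
  refine LinearMap.ext fun y ↦ funext fun i ↦ ?_
  change singularHomologyTwoThreeTorusEquiv hPD (singularHomology.map ℤ ℤ (torusMapC A) 2 y) i =
    Matrix.mulVec (A⁻¹).1.transpose (singularHomologyTwoThreeTorusEquiv hPD y) i
  set D := pdEquiv hPD with hD
  set a := D.symm y with ha
  -- (1) `f_* y = D (g^* a)` with `g = torusMap A⁻¹`
  have hfg : singularCohomology.map ℤ ℤ (torusMapC A) 1
      (singularCohomology.map ℤ ℤ (torusMapC A⁻¹) 1 a) = a := by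
    rw [← ModuleCat.comp_apply, ← singularCohomology.map_comp, torusMapC_inv_comp,
      singularCohomology.map_id, ModuleCat.id_apply]
  have h1 : singularHomology.map ℤ ℤ (torusMapC A) 2 y =
      D (singularCohomology.map ℤ ℤ (torusMapC A⁻¹) 1 a) := by
    conv_lhs => rw [← D.apply_symm_apply y, ← ha, ← hfg]
    rw [hD, pdEquiv_apply, pdEquiv_apply]
    exact map_torusMapC_poincareDualityMap A _
  rw [singularHomologyTwoThreeTorusEquiv_apply, ← hD, h1, D.symm_apply_apply, kroneckerPairing_map,
    map_torusMapC_classOne, map_sum, Matrix.mulVec, dotProduct]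
  refine Finset.sum_congr rfl fun j _ ↦ ?_
  rw [map_zsmul, smul_eq_mul, singularHomologyTwoThreeTorusEquiv_apply, ← hD, ← ha,
    Matrix.transpose_apply]

end ThreeTorus

/-! ### The torus input and the Cappell–Shaneson target fact -/

open ThreeTorus

/-- **The `H₂` half of `singularHomology_threeTorus_linear` from Poincaré duality for `T³`.**
[cite: HatcherAT2002, §3.C Exercise 11] -/
theorem exists_iso_singularHomology_two_threeTorus (hPD : PD₃) :
    ∃ β₂ : singularHomology ℤ ℤ ThreeTorus 2 ≅ ModuleCat.of ℤ (Fin 3 → ℤ),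
      ∀ A : Matrix.SpecialLinearGroup (Fin 3) ℤ,
        singularHomology.map ℤ ℤ (torusMapC A) 2 ≫ β₂.hom =
          β₂.hom ≫ ModuleCat.ofHom (Matrix.mulVecLin ((A⁻¹).1.transpose)) :=
  ⟨singularHomologyTwoThreeTorusIso hPD, map_torusMapC_two_comp_iso hPD⟩

/-- **The named fact `singularHomology_threeTorus_linear` (Hatcher §3.C Exercise 11 / Example
3.16: `H₁(T³; ℤ) ≅ ℤ³`, `H₂(T³; ℤ) ≅ ℤ³` with `torusMap A` acting by `A` and `(A⁻¹)ᵀ`) from Poincaré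
duality for `T³` in degrees `(1, 2)` alone** — the `H₁` half is proved outright
(`ThreeTorusHomologyOne.lean`), the `H₂` half is its Poincaré dual. [cite: HatcherAT2002, §3.C Exercise 11] -/
theorem singularHomology_threeTorus_linear_of_poincareDuality (hPD : PD₃) :
    singularHomology_threeTorus_linear :=
  ⟨singularHomologyOneThreeTorusIso, singularHomologyTwoThreeTorusIso hPD, fun A ↦
    ⟨map_torusMapC_one_comp_iso A, map_torusMapC_two_comp_iso hPD A⟩⟩

/-- **Cappell–Shaneson spheres are homotopy 4-spheres, from Poincaré duality for `T³` and the
recognition of homotopy 4-spheres** (every universe): the target fact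
`nonempty_homotopyEquiv_sphere_four_of_isCappellShanesonSphere` (Cappell–Shaneson, Ann. of Math.
104 (1976), §2) follows from (PD₃) `bijective_poincareDualityMap` for `T³` in degrees `(1, 2)`
(Hatcher Thm. 3.30) and (W) `nonempty_homotopyEquiv_sphere_four_iff` at universe `0`
(`spc4.S10`); the fundamental group, the Mayer–Vietoris and Wang sequences, the homology of
spheres, the orientation, fundamental class and `H₁` of `T³` are theorems of the tree.
[cite: CappellShanesonAnnals1976, §2] -/
theorem nonempty_homotopyEquiv_sphere_four_of_isCappellShanesonSphere_of_poincareDuality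
    (hPD : PD₃) (hW : nonempty_homotopyEquiv_sphere_four_iff.{0})
    (X : Type u) [TopologicalSpace X] [ChartedSpace (𝔼 4) X] :
    nonempty_homotopyEquiv_sphere_four_of_isCappellShanesonSphere X :=
  nonempty_homotopyEquiv_sphere_four_of_isCappellShanesonSphere_of_torusFacts'''
    (singularHomology_threeTorus_linear_of_poincareDuality hPD) hW X

/-- **Cappell–Shaneson spheres are homotopy 4-spheres, from the three textbook theorems behind
`spc4.S10`** (every universe): the target fact follows from Poincaré duality for closed oriented
manifolds (Hatcher Thm. 3.30, the named fact `bijective_poincareDualityMap`, used for `T³` in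
degrees `(1, 2)` and for closed 4-manifolds in degrees `(1, 3)`), Whitehead's theorem (Cor. 4.33,
`whitehead_exists_homotopyEquiv`) and the CW homotopy type of compact manifolds (Cor. A.12,
`exists_cwComplex_homotopyEquiv_of_compactSpace`), the latter two only through `spc4.S10`
(`nonempty_homotopyEquiv_sphere_four_iff_of_facts`, `HomotopyS4Criterion.lean`). Every statement
specific to `T³`, to mapping tori, to the surgery or to Cappell–Shaneson spheres is proved.
[cite: CappellShanesonAnnals1976, §2] [cite: HatcherAT2002, Thm. 3.30, Cor. 4.33, Cor. A.12] -/
theorem nonempty_homotopyEquiv_sphere_four_of_isCappellShanesonSphere_of_textbookFacts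
    (hPD : ∀ (M : Type) [TopologicalSpace M] [CompactSpace M] [T2Space M] (n : ℕ)
      [ChartedSpace (𝔼 n) M] (μ : HomologicalOrientation ℤ M n) (p q : ℕ) (h : p + q = n),
      bijective_poincareDualityMap μ h)
    (hW : Literature.AlgebraicTopology.Homotopy.whitehead_exists_homotopyEquiv.{0})
    (hCW : Literature.AlgebraicTopology.Homotopy.exists_cwComplex_homotopyEquiv_of_compactSpace.{0})
    (X : Type u) [TopologicalSpace X] [ChartedSpace (𝔼 4) X] :
    nonempty_homotopyEquiv_sphere_four_of_isCappellShanesonSphere X :=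
  nonempty_homotopyEquiv_sphere_four_of_isCappellShanesonSphere_of_poincareDuality
    (@hPD ThreeTorus _ _ _ 3 threeTorusChartedSpaceFinThree ThreeTorus.homologicalOrientation 1 2 rfl)
    (nonempty_homotopyEquiv_sphere_four_iff_of_facts
      (fun M _ _ _ _ μ ↦ hPD M 4 μ 1 3 (Nat.add_comm 1 3)) hW hCW) X

end Literature.Topology.FourManifolds

end
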